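import Mathlib.Analysis.SpecialFunctions.Pow.Real
import Literature.NumberTheory.Sieve.ShiuTheoremProofs
import HarnessLib

/-!
# Lattice points in thin hyperbolic shells and under hyperbolas

Topic `Literature/NumberTheory/Sieve`.  Everything here is PROVED; no definition is introduced.
Elementary counting lemmas used to discard boundary layers in divisor-sum / dispersion arguments
(the "shells" `X < d₀d₁ ≤ (1 + κ)X` left over when a sharp hyperbolic cut-off is replaced by a
box-uniform one):

* `HyperbolicShell.card_le_of_modEq_of_diam_le` — a set of naturals in one residue class
  modulo `L` and of diameter `≤ t` has at most `t/L + 1` elements;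
* `HyperbolicShell.card_filter_mul_mem_Ioc_le` — `#{d₁ : X < d d₁ ≤ X + Y} ≤ Y/d + 1`;
* `HyperbolicShell.card_pairs_shell_le` — **pairs in a thin hyperbolic shell**:
  `#{(d₀,d₁) ∈ [1,B]² : X < d₀d₁ ≤ X + Y} ≤ 2Y(1 + log(X+Y)) + 2√(X+Y)` for `X ≥ 1`, `Y ≥ 0`
  (Dirichlet's hyperbola trick: one of the two variables is at most `√(X+Y)`, the other one runs
  over the multiples in an interval of length `Y`);
* `HyperbolicShell.sum_pairs_hyperbola_le` — the weighted count under a hyperbola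
  `∑_{m₀m₁ ≤ W} (K/(m₀m₁) + 1) ≤ K(1 + log W)² + W(1 + log W)`.

All bounds are uniform in the size `B` of the ambient box.  The harmonic-sum input is
`Shiu.sum_Icc_inv_le_one_add_log` (`∑_{m ≤ R} 1/m ≤ 1 + log R`).

## References

* G. H. Hardy, E. M. Wright, *An Introduction to the Theory of Numbers*, Thm 320 (Dirichlet's
  hyperbola method). [folklore]
-/

open Finset Real

namespace Literature.NumberTheory.Sieve

namespace HyperbolicShell

/-! ### Counting in one residue class -/

/-- A finite set of naturals contained in one residue class modulo `L ≥ 1` and of diameter at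
most `t` has at most `t/L + 1` elements. [folklore] -/
theorem card_le_of_modEq_of_diam_le {S : Finset ℕ} {L : ℕ} (hL : 0 < L)
    (hmod : ∀ a ∈ S, ∀ b ∈ S, a ≡ b [MOD L]) {t : ℝ} (ht : 0 ≤ t)
    (hdiam : ∀ a ∈ S, ∀ b ∈ S, (b : ℝ) - a ≤ t) :
    (S.card : ℝ) ≤ t / L + 1 := by
  rcases S.eq_empty_or_nonempty with rfl | hne
  · simp only [Finset.card_empty, Nat.cast_zero]; positivity
  · set m := S.min' hne with hm
    have hmS : m ∈ S := S.min'_mem hne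
    have hmle : ∀ a ∈ S, m ≤ a := fun a ha => S.min'_le a ha
    have key : S.card ≤ (Finset.range (⌊t⌋₊ / L + 1)).card := by
      refine Finset.card_le_card_of_injOn (fun a => (a - m) / L) ?_ ?_
      · intro a ha
        rw [Finset.mem_coe] at ha
        rw [Finset.mem_coe, Finset.mem_range, Nat.lt_add_one_iff]
        refine Nat.div_le_div_right ?_
        have h := hdiam m hmS a ha
        have : ((a - m : ℕ) : ℝ) ≤ t := by rw [Nat.cast_sub (hmle a ha)]; exact h
        exact Nat.le_floor this
      · intro a ha b hb hab
        rw [Finset.mem_coe] at ha hb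
        have hLa : L ∣ a - m := (Nat.modEq_iff_dvd' (hmle a ha)).1 (hmod m hmS a ha)
        have hLb : L ∣ b - m := (Nat.modEq_iff_dvd' (hmle b hb)).1 (hmod m hmS b hb)
        have hab' : (a - m) / L = (b - m) / L := hab
        have h1 : a - m = b - m := by
          rw [← Nat.div_mul_cancel hLa, ← Nat.div_mul_cancel hLb, hab']
        have := hmle a ha; have := hmle b hb
        omega
    rw [Finset.card_range] at key
    have hL' : (0 : ℝ) < L := by exact_mod_cast hL
    calc (S.card : ℝ) ≤ ((⌊t⌋₊ / L + 1 : ℕ) : ℝ) := by exact_mod_cast key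
      _ = ((⌊t⌋₊ / L : ℕ) : ℝ) + 1 := by push_cast; ring
      _ ≤ (⌊t⌋₊ : ℝ) / L + 1 := by gcongr; exact Nat.cast_div_le
      _ ≤ t / L + 1 := by gcongr; exact Nat.floor_le ht


/-! ### Lattice points in hyperbolic regions -/

/-- Multiples in a real interval: for `d ≥ 1`, `X, Y ≥ 0` and any `B`,
`#{d₁ ∈ [1, B] : X < d·d₁ ≤ X + Y} ≤ Y/d + 1`. [folklore] -/
theorem card_filter_mul_mem_Ioc_le {d : ℕ} (hd : 0 < d) {X Y : ℝ} (hX : 0 ≤ X) (hY : 0 ≤ Y)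
    (B : ℕ) :
    (((Icc 1 B).filter fun d₁ : ℕ => X < (d : ℝ) * d₁ ∧ (d : ℝ) * d₁ ≤ X + Y).card : ℝ) ≤
      Y / d + 1 := by
  have hd' : (0 : ℝ) < d := by exact_mod_cast hd
  have hsub : ((Icc 1 B).filter fun d₁ : ℕ => X < (d : ℝ) * d₁ ∧ (d : ℝ) * d₁ ≤ X + Y) ⊆
      Ioc ⌊X / d⌋₊ ⌊(X + Y) / d⌋₊ := by
    intro d₁ h
    rw [Finset.mem_filter] at h
    obtain ⟨-, h1, h2⟩ := h
    rw [Finset.mem_Ioc]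
    constructor
    · rw [Nat.floor_lt (by positivity), div_lt_iff₀ hd']
      linarith [mul_comm (d : ℝ) d₁]
    · rw [Nat.le_floor_iff (by positivity), le_div_iff₀ hd']
      linarith [mul_comm (d : ℝ) d₁]
  calc (((Icc 1 B).filter fun d₁ : ℕ => X < (d : ℝ) * d₁ ∧ (d : ℝ) * d₁ ≤ X + Y).card : ℝ)
      ≤ ((Ioc ⌊X / d⌋₊ ⌊(X + Y) / d⌋₊).card : ℝ) := by exact_mod_cast Finset.card_le_card hsub
    _ = (⌊(X + Y) / d⌋₊ : ℝ) - ⌊X / d⌋₊ := by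
        rw [Nat.card_Ioc, Nat.cast_sub (Shiu.floor_le_floor_div hY hd')]
    _ ≤ Y / d + 1 := Shiu.floor_sub_floor_le hX hY hd'

/-- Half of the shell count: the pairs with `d₀ ≤ ⌊√(X+Y)⌋` number at most
`Y(1 + log(X+Y)) + √(X+Y)`. [folklore] -/
theorem card_pairs_shell_fst_le {X Y : ℝ} (hX : 1 ≤ X) (hY : 0 ≤ Y) (B : ℕ) :
    ((((Icc 1 B) ×ˢ (Icc 1 B)).filter fun p : ℕ × ℕ =>
        (X < (p.1 : ℝ) * p.2 ∧ (p.1 : ℝ) * p.2 ≤ X + Y) ∧ p.1 ≤ ⌊Real.sqrt (X + Y)⌋₊).card : ℝ) ≤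
      Y * (1 + Real.log (X + Y)) + Real.sqrt (X + Y) := by
  set R : ℕ := ⌊Real.sqrt (X + Y)⌋₊ with hR
  have hZ1 : 1 ≤ X + Y := by linarith
  have hZ0 : 0 < X + Y := by linarith
  have hX0 : 0 ≤ X := by linarith
  have hRle : (R : ℝ) ≤ Real.sqrt (X + Y) := Nat.floor_le (Real.sqrt_nonneg _)
  have hsqrt1 : 1 ≤ Real.sqrt (X + Y) := by
    rw [show (1 : ℝ) = Real.sqrt 1 from Real.sqrt_one.symm]; exact Real.sqrt_le_sqrt hZ1
  have hsqrtZ : Real.sqrt (X + Y) ≤ X + Y := by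
    rw [Real.sqrt_le_left (by linarith)]; nlinarith
  have hlogR : Real.log R ≤ Real.log (X + Y) := by
    rcases Nat.eq_zero_or_pos R with h0 | hpos
    · rw [h0, Nat.cast_zero, Real.log_zero]; exact Real.log_nonneg hZ1
    · exact Real.log_le_log (by exact_mod_cast hpos) (hRle.trans hsqrtZ)
  rw [Finset.card_filter, Nat.cast_sum, Finset.sum_product]
  -- inner sums
  have hinner : ∀ d₀ ∈ Icc 1 B,
      ∑ d₁ ∈ Icc 1 B, (((if (X < (d₀ : ℝ) * d₁ ∧ (d₀ : ℝ) * d₁ ≤ X + Y) ∧ d₀ ≤ R then 1 else 0 : ℕ)) : ℝ)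
        ≤ if d₀ ≤ R then Y / d₀ + 1 else 0 := by
    intro d₀ hd₀
    rw [Finset.mem_Icc] at hd₀
    by_cases h : d₀ ≤ R
    · rw [if_pos h]
      have := card_filter_mul_mem_Ioc_le hd₀.1 hX0 hY B
      rw [Finset.card_filter, Nat.cast_sum] at this
      refine le_trans (le_of_eq ?_) this
      refine Finset.sum_congr rfl fun d₁ _ => ?_
      by_cases h' : X < (d₀ : ℝ) * d₁ ∧ (d₀ : ℝ) * d₁ ≤ X + Y
      · rw [if_pos ⟨h', h⟩, if_pos h']
      · rw [if_neg (fun hh => h' hh.1), if_neg h']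
    · rw [if_neg h]
      refine le_of_eq (Finset.sum_eq_zero fun d₁ _ => ?_)
      rw [if_neg (fun hh => h hh.2), Nat.cast_zero]
  refine (Finset.sum_le_sum hinner).trans ?_
  rw [← Finset.sum_filter]
  have hsub : (Icc 1 B).filter (fun d₀ : ℕ => d₀ ≤ R) ⊆ Icc 1 R := by
    intro d₀ h
    rw [Finset.mem_filter, Finset.mem_Icc] at h
    rw [Finset.mem_Icc]
    exact ⟨h.1.1, h.2⟩
  have hnn : ∀ d₀ ∈ Icc 1 R, (0 : ℝ) ≤ Y / d₀ + 1 := fun d₀ _ => by positivity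
  refine (Finset.sum_le_sum_of_subset_of_nonneg hsub fun d₀ h _ => hnn d₀ h).trans ?_
  rw [Finset.sum_add_distrib, Finset.sum_const, Nat.card_Icc, add_tsub_cancel_right,
    nsmul_eq_mul, mul_one]
  have hharm : ∑ d₀ ∈ Icc 1 R, Y / (d₀ : ℝ) ≤ Y * (1 + Real.log (X + Y)) := by
    have h1 := Shiu.sum_Icc_inv_le_one_add_log R
    calc ∑ d₀ ∈ Icc 1 R, Y / (d₀ : ℝ) = Y * ∑ d₀ ∈ Icc 1 R, (1 : ℝ) / d₀ := by
          rw [Finset.mul_sum]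
          refine Finset.sum_congr rfl fun d₀ _ => ?_
          ring
      _ ≤ Y * (1 + Real.log R) := mul_le_mul_of_nonneg_left h1 hY
      _ ≤ Y * (1 + Real.log (X + Y)) := by gcongr
  linarith

/-- **Pairs in a thin hyperbolic shell**: for `X ≥ 1`, `Y ≥ 0` and any `B`,
`#{(d₀,d₁) ∈ [1,B]² : X < d₀d₁ ≤ X + Y} ≤ 2Y(1 + log(X+Y)) + 2√(X+Y)` (one of `d₀, d₁` is at
most `√(X+Y)`; the other ranges over the multiples in an interval of length `Y`). [folklore] -/
theorem card_pairs_shell_le {X Y : ℝ} (hX : 1 ≤ X) (hY : 0 ≤ Y) (B : ℕ) :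
    ((((Icc 1 B) ×ˢ (Icc 1 B)).filter fun p : ℕ × ℕ =>
        X < (p.1 : ℝ) * p.2 ∧ (p.1 : ℝ) * p.2 ≤ X + Y).card : ℝ) ≤
      2 * Y * (1 + Real.log (X + Y)) + 2 * Real.sqrt (X + Y) := by
  set R : ℕ := ⌊Real.sqrt (X + Y)⌋₊ with hR
  set S := (Icc 1 B) ×ˢ (Icc 1 B) with hS
  set A₁ := S.filter fun p : ℕ × ℕ =>
    (X < (p.1 : ℝ) * p.2 ∧ (p.1 : ℝ) * p.2 ≤ X + Y) ∧ p.1 ≤ R with hA₁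
  set A₂ := S.filter fun p : ℕ × ℕ =>
    (X < (p.1 : ℝ) * p.2 ∧ (p.1 : ℝ) * p.2 ≤ X + Y) ∧ p.2 ≤ R with hA₂
  have h1 : (A₁.card : ℝ) ≤ Y * (1 + Real.log (X + Y)) + Real.sqrt (X + Y) :=
    card_pairs_shell_fst_le hX hY B
  -- `A₂` is the mirror image of `A₁`
  have h2 : A₂.card = A₁.card := by
    refine Finset.card_nbij' Prod.swap Prod.swap ?_ ?_ (fun p _ => Prod.swap_swap p)
      (fun p _ => Prod.swap_swap p)
    · intro p hp
      rw [Finset.mem_coe, hA₂, Finset.mem_filter, hS, Finset.mem_product] at hp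
      rw [Finset.mem_coe, hA₁, Finset.mem_filter, hS, Finset.mem_product]
      obtain ⟨⟨hp1, hp2⟩, ⟨hw1, hw2⟩, hr⟩ := hp
      refine ⟨⟨hp2, hp1⟩, ⟨?_, ?_⟩, hr⟩
      · simpa [Prod.fst_swap, Prod.snd_swap, mul_comm] using hw1
      · simpa [Prod.fst_swap, Prod.snd_swap, mul_comm] using hw2
    · intro p hp
      rw [Finset.mem_coe, hA₁, Finset.mem_filter, hS, Finset.mem_product] at hp
      rw [Finset.mem_coe, hA₂, Finset.mem_filter, hS, Finset.mem_product]
      obtain ⟨⟨hp1, hp2⟩, ⟨hw1, hw2⟩, hr⟩ := hp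
      refine ⟨⟨hp2, hp1⟩, ⟨?_, ?_⟩, hr⟩
      · simpa [Prod.fst_swap, Prod.snd_swap, mul_comm] using hw1
      · simpa [Prod.fst_swap, Prod.snd_swap, mul_comm] using hw2
  -- every pair of the shell is in `A₁ ∪ A₂`
  have hsub : (S.filter fun p : ℕ × ℕ => X < (p.1 : ℝ) * p.2 ∧ (p.1 : ℝ) * p.2 ≤ X + Y) ⊆
      A₁ ∪ A₂ := by
    intro p hp
    rw [Finset.mem_filter] at hp
    obtain ⟨hpS, hw1, hw2⟩ := hp
    rw [Finset.mem_union, hA₁, hA₂, Finset.mem_filter, Finset.mem_filter]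
    have hsq : ∀ k : ℕ, ((k : ℝ)) * k ≤ X + Y → k ≤ R := by
      intro k hk
      rw [hR]
      refine Nat.le_floor ?_
      rw [show (k : ℝ) = Real.sqrt ((k : ℝ) * k) by
        rw [Real.sqrt_mul_self (Nat.cast_nonneg k)]]
      exact Real.sqrt_le_sqrt hk
    rcases le_or_gt p.1 p.2 with hle | hlt
    · left
      refine ⟨hpS, ⟨hw1, hw2⟩, hsq p.1 ?_⟩
      have : (p.1 : ℝ) * p.1 ≤ (p.1 : ℝ) * p.2 := by
        have h : (p.1 : ℝ) ≤ p.2 := by exact_mod_cast hle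
        exact mul_le_mul_of_nonneg_left h (Nat.cast_nonneg _)
      linarith
    · right
      refine ⟨hpS, ⟨hw1, hw2⟩, hsq p.2 ?_⟩
      have : (p.2 : ℝ) * p.2 ≤ (p.1 : ℝ) * p.2 := by
        have h : (p.2 : ℝ) ≤ p.1 := by exact_mod_cast hlt.le
        exact mul_le_mul_of_nonneg_right h (Nat.cast_nonneg _)
      linarith
  have hcard := (Finset.card_le_card hsub).trans (Finset.card_union_le A₁ A₂)
  rw [h2] at hcard
  have : ((S.filter fun p : ℕ × ℕ => X < (p.1 : ℝ) * p.2 ∧ (p.1 : ℝ) * p.2 ≤ X + Y).card : ℝ) ≤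
      (A₁.card : ℝ) + A₁.card := by exact_mod_cast hcard
  linarith

/-- **Weighted count under a hyperbola**: for `W ≥ 1`, `K ≥ 0` and any `B`,
`∑_{(m₀,m₁) ∈ [1,B]², m₀m₁ ≤ W} (K/(m₀m₁) + 1) ≤ K(1 + log W)² + W(1 + log W)`. [folklore] -/
theorem sum_pairs_hyperbola_le {W K : ℝ} (hW : 1 ≤ W) (hK : 0 ≤ K) (B : ℕ) :
    ∑ p ∈ (Icc 1 B) ×ˢ (Icc 1 B),
        (if (p.1 : ℝ) * p.2 ≤ W then K / ((p.1 : ℝ) * p.2) + 1 else 0) ≤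
      K * (1 + Real.log W) ^ 2 + W * (1 + Real.log W) := by
  have hW0 : 0 < W := by linarith
  set V : ℕ := ⌊W⌋₊ with hV
  have hV1 : 1 ≤ V := Nat.le_floor (by simpa using hW)
  have hVW : (V : ℝ) ≤ W := Nat.floor_le hW0.le
  have hlogV : Real.log V ≤ Real.log W :=
    Real.log_le_log (by exact_mod_cast hV1) hVW
  have hharm : ∑ m ∈ Icc 1 V, (1 : ℝ) / m ≤ 1 + Real.log W :=
    (Shiu.sum_Icc_inv_le_one_add_log V).trans (by linarith)
  have hharm0 : 0 ≤ ∑ m ∈ Icc 1 V, (1 : ℝ) / m := Finset.sum_nonneg fun m _ => by positivity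
  have hlogW1 : 0 ≤ 1 + Real.log W := by have := Real.log_nonneg hW; linarith
  -- `[m ≤ W]/m` summed over `[1, B]` is at most the harmonic sum up to `V`
  have hrestrict : ∀ g : ℕ → ℝ, (∀ m, 0 ≤ g m) →
      ∑ m ∈ Icc 1 B, (if (m : ℝ) ≤ W then g m else 0) ≤ ∑ m ∈ Icc 1 V, g m := by
    intro g hg
    rw [← Finset.sum_filter]
    refine Finset.sum_le_sum_of_subset_of_nonneg ?_ fun m _ _ => hg m
    intro m hm
    rw [Finset.mem_filter, Finset.mem_Icc] at hm
    rw [Finset.mem_Icc]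
    exact ⟨hm.1.1, Nat.le_floor hm.2⟩
  -- split the summand
  have hsplit : ∀ p : ℕ × ℕ, (if (p.1 : ℝ) * p.2 ≤ W then K / ((p.1 : ℝ) * p.2) + 1 else 0) =
      (if (p.1 : ℝ) * p.2 ≤ W then K / ((p.1 : ℝ) * p.2) else 0) +
        (if (p.1 : ℝ) * p.2 ≤ W then (1 : ℝ) else 0) := by
    intro p; split_ifs <;> ring
  rw [Finset.sum_congr rfl fun p _ => hsplit p, Finset.sum_add_distrib]
  refine add_le_add ?_ ?_
  · -- the `K`-part
    rw [Finset.sum_product]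
    have hpt : ∀ m₀ ∈ Icc 1 B, ∀ m₁ ∈ Icc 1 B,
        (if (m₀ : ℝ) * m₁ ≤ W then K / ((m₀ : ℝ) * m₁) else 0) ≤
          (if (m₀ : ℝ) ≤ W then 1 / (m₀ : ℝ) else 0) * (if (m₁ : ℝ) ≤ W then K / (m₁ : ℝ) else 0) := by
      intro m₀ hm₀ m₁ hm₁
      rw [Finset.mem_Icc] at hm₀ hm₁
      have h0 : (1 : ℝ) ≤ m₀ := by exact_mod_cast hm₀.1
      have h1 : (1 : ℝ) ≤ m₁ := by exact_mod_cast hm₁.1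
      by_cases h : (m₀ : ℝ) * m₁ ≤ W
      · have hm₀W : (m₀ : ℝ) ≤ W := by nlinarith
        have hm₁W : (m₁ : ℝ) ≤ W := by nlinarith
        rw [if_pos h, if_pos hm₀W, if_pos hm₁W]
        rw [div_mul_div_comm, one_mul]
      · rw [if_neg h]
        split_ifs <;> positivity
    calc ∑ m₀ ∈ Icc 1 B, ∑ m₁ ∈ Icc 1 B, (if ((m₀, m₁).1 : ℝ) * (m₀, m₁).2 ≤ W then
            K / (((m₀, m₁).1 : ℝ) * (m₀, m₁).2) else 0)
        ≤ ∑ m₀ ∈ Icc 1 B, ∑ m₁ ∈ Icc 1 B,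
            (if (m₀ : ℝ) ≤ W then 1 / (m₀ : ℝ) else 0) * (if (m₁ : ℝ) ≤ W then K / (m₁ : ℝ) else 0) :=
          Finset.sum_le_sum fun m₀ hm₀ => Finset.sum_le_sum fun m₁ hm₁ => hpt m₀ hm₀ m₁ hm₁
      _ = (∑ m₀ ∈ Icc 1 B, (if (m₀ : ℝ) ≤ W then 1 / (m₀ : ℝ) else 0)) *
            ∑ m₁ ∈ Icc 1 B, (if (m₁ : ℝ) ≤ W then K / (m₁ : ℝ) else 0) := by
          rw [Finset.sum_mul_sum]
      _ ≤ (∑ m ∈ Icc 1 V, (1 : ℝ) / m) * ∑ m ∈ Icc 1 V, K / (m : ℝ) := by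
          refine mul_le_mul (hrestrict _ fun m => by positivity) (hrestrict _ fun m => by positivity)
            (Finset.sum_nonneg fun m _ => by split_ifs <;> positivity) hharm0
      _ = K * (∑ m ∈ Icc 1 V, (1 : ℝ) / m) ^ 2 := by
          rw [sq, show ∑ m ∈ Icc 1 V, K / (m : ℝ) = K * ∑ m ∈ Icc 1 V, (1 : ℝ) / m by
            rw [Finset.mul_sum]; refine Finset.sum_congr rfl fun m _ => ?_; ring]
          ring
      _ ≤ K * (1 + Real.log W) ^ 2 := by
          gcongr
  · -- the counting part
    rw [Finset.sum_product]
    have hinner : ∀ m₀ ∈ Icc 1 B,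
        ∑ m₁ ∈ Icc 1 B, (if ((m₀ : ℝ)) * m₁ ≤ W then (1 : ℝ) else 0) ≤
          if (m₀ : ℝ) ≤ W then W / m₀ else 0 := by
      intro m₀ hm₀
      rw [Finset.mem_Icc] at hm₀
      have hm₀pos : (0 : ℝ) < m₀ := by exact_mod_cast hm₀.1
      rw [← Finset.sum_filter, Finset.sum_const, nsmul_eq_mul, mul_one]
      have hsub : (Icc 1 B).filter (fun m₁ : ℕ => (m₀ : ℝ) * m₁ ≤ W) ⊆ Icc 1 ⌊W / m₀⌋₊ := by
        intro m₁ hm₁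
        rw [Finset.mem_filter, Finset.mem_Icc] at hm₁
        rw [Finset.mem_Icc]
        refine ⟨hm₁.1.1, Nat.le_floor ?_⟩
        rw [le_div_iff₀ hm₀pos]; linarith [mul_comm (m₀ : ℝ) m₁, hm₁.2]
      have hc : ((((Icc 1 B).filter (fun m₁ : ℕ => (m₀ : ℝ) * m₁ ≤ W)).card : ℕ) : ℝ) ≤ W / m₀ := by
        calc ((((Icc 1 B).filter (fun m₁ : ℕ => (m₀ : ℝ) * m₁ ≤ W)).card : ℕ) : ℝ)
            ≤ ((Icc 1 ⌊W / m₀⌋₊).card : ℝ) := by exact_mod_cast Finset.card_le_card hsub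
          _ = ⌊W / m₀⌋₊ := by rw [Nat.card_Icc, add_tsub_cancel_right]
          _ ≤ W / m₀ := Nat.floor_le (by positivity)
      by_cases h : (m₀ : ℝ) ≤ W
      · rw [if_pos h]; exact hc
      · rw [if_neg h]
        have hempty : (Icc 1 B).filter (fun m₁ : ℕ => (m₀ : ℝ) * m₁ ≤ W) = ∅ := by
          rw [Finset.filter_eq_empty_iff]
          intro m₁ hm₁ hle
          rw [Finset.mem_Icc] at hm₁
          have h1 : (1 : ℝ) ≤ m₁ := by exact_mod_cast hm₁.1
          push Not at h
          nlinarith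
        rw [hempty, Finset.card_empty, Nat.cast_zero]
    calc ∑ m₀ ∈ Icc 1 B, ∑ m₁ ∈ Icc 1 B, (if ((m₀, m₁).1 : ℝ) * (m₀, m₁).2 ≤ W then (1 : ℝ) else 0)
        ≤ ∑ m₀ ∈ Icc 1 B, (if (m₀ : ℝ) ≤ W then W / m₀ else 0) := Finset.sum_le_sum hinner
      _ ≤ ∑ m₀ ∈ Icc 1 V, W / (m₀ : ℝ) := hrestrict _ fun m => by positivity
      _ = W * ∑ m ∈ Icc 1 V, (1 : ℝ) / m := by
          rw [Finset.mul_sum]; refine Finset.sum_congr rfl fun m _ => ?_; ring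
      _ ≤ W * (1 + Real.log W) := mul_le_mul_of_nonneg_left hharm hW0.le

end HyperbolicShell

end Literature.NumberTheory.Sieve
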